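import Mathlib
import HarnessLib
import Summits.HubbardSuperconductivity.HubbardSuperconductivity.Theorems.KLProgrammeC4aPathJets
import Summits.HubbardSuperconductivity.HubbardSuperconductivity.Theorems.KLProgrammeC4aJacSymbol
import Summits.HubbardSuperconductivity.HubbardSuperconductivity.Theorems.KLProgrammePerturbedFermiCurveWindowJetsDefs
import Summits.HubbardSuperconductivity.HubbardSuperconductivity.Theorems.KLProgrammeKLRegimeCountertermFrameCurveLipschitz

/-!
# Route `KLProgramme` — crux C4a, (L3) bridge: THE RANGE OF THE CO-MOVING PATHS — `‖Φ(0,θ) ± Φ(ρ,ϑ+θ)‖ ≤ 2·u_max` (the input `hR` of the ball version)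

Cell `gate-hubbard-kl`, lane hubbard-kl-c4a-1 (g6); helper for stub (C) `stub_twoLeg_curvature` of the engine-flow child `KLRegimeEngineV17F2`
(stmt-HubbardSuperconductivity-20437); memo HOME/hubbard-kl-c4a-1/C4A-PLAN.md §23.3 (d2).  `…C4aPairJetsL1Ball` asks the bubble majorants on a ball `‖p‖ ≤ R₀` with
`hR : ‖pairSumPath μ K ρ ϑ θ 0‖ ≤ R₀` (resp. `pairDiffPath`).  Here `R₀ = 2·T.umax` from a polar-jet table (`PerturbedFermiCurve.FreeBandPolarJets a b T`, KLCert pattern):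
`‖Φ(ρ,ϑ)‖ = u_K(μ+ρ;ϑ)` (`…C4aJacSymbol.norm_levelPoint`), `u_K ≤ u₀(· + A) ≤ T.umax` (`bandFermiRadius_le_perturbedFermiRadius_le`, `FreeBandPolarJets.le_umax`).
On the window `[-1.1, -0.1]` of record (`KlwjCertB`, `klwjTableB.umax = 2.826`): `R₀ = 5.652 < 2π − 0.63` — the `2πℤ²`-images of the Cooper / forward singularity of the
periodic bubbles stay at distance `> 0.63` from the path range (`norm_pairSumPath_zero_le_klwjB`, `norm_pairDiffPath_zero_le_klwjB`).

Bookkeeping on landed theorems; nothing about the model's sizes; nothing asserts superconductivity.  Reference: BGM 2006 §2.4 (2.40) [cite: BenfattoGiulianiMastropietro2006].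
-/

noncomputable section

namespace Summit.HubbardSuperconductivity.HubbardSuperconductivity.Theorems.C4a

set_option linter.dupNamespace false -- summit = problem name (single-conjunct summit), D-0017

open Real Set
open Literature.MathematicalPhysics.QuantumLattice Literature.MathematicalPhysics.QuantumLattice.BandSectorCounting Literature.Probability.LatticeModels
open Summit.HubbardSuperconductivity.HubbardSuperconductivity.Theorems.KLRegimeSplit
open Summit.HubbardSuperconductivity.HubbardSuperconductivity.Theorems.DispersionFlow
open Summit.HubbardSuperconductivity.HubbardSuperconductivity.Theorems.PerturbedFermiCurve

section Band

variable {a b : ℝ} (B : BandBounds a b) {T : PolarJetTable} (hT : FreeBandPolarJets a b T) {K : TrigPolyC4v} {A : ℝ}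
  (hA : ∀ p : Momentum, ∀ j ≤ 2, ‖iteratedFDeriv ℝ j (frameShift K) p‖ ≤ A)
include B hT hA

/-- **The frame's radius is at most the table's `umax`**: `u_K(ν; s) ≤ u₀(ν + A; s) ≤ T.umax` for `[ν − A, ν + A] ⊂ [a, b]`. [cite: BenfattoGiulianiMastropietro2006, §2.4 (2.40)] -/
theorem frameRadius_le_umax {ν : ℝ} (hlo : a ≤ ν - A) (hhi : ν + A ≤ b) (s : ℝ) :
    perturbedFermiRadius (fun p : Fin 2 → ℝ => -K.eval p) ν s ≤ T.umax :=
  have hA0 : 0 ≤ A := (norm_nonneg _).trans (hA 0 0 (by norm_num))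
  (bandFermiRadius_le_perturbedFermiRadius_le B (by rw [← frameShift_toLp_eq_neg_eval]; exact continuous_frameShift_toLp K)
    (abs_neg_eval_le_of_frameSize hA) hlo hhi s).2.trans (hT.le_umax (ν + A) ⟨by linarith, hhi⟩ s)

/-- **`‖Φ(ρ, ϑ)‖ ≤ T.umax`** for a tube level `μ + ρ` with `(μ + ρ) ∓ A` strictly inside the window. -/
theorem norm_levelPoint_le_umax {μ ρ : ℝ} (hlo : a < μ + ρ - A) (hhi : μ + ρ + A < b) (ϑ : ℝ) : ‖levelPoint μ K ρ ϑ‖ ≤ T.umax := by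
  rw [norm_levelPoint B hA hlo hhi ϑ]
  exact frameRadius_le_umax B hT hA hlo.le hhi.le ϑ

/-- **The range of the pair-sum path**: `‖Φ(0,θ) + Φ(ρ,ϑ+θ)‖ ≤ 2·T.umax` (`|ρ| < r`, tube margins `a < μ − r − A`, `μ + r + A < b`). -/
theorem norm_pairSumPath_zero_le_umax {μ r : ℝ} (hlo : a < μ - r - A) (hhi : μ + r + A < b) {ρ : ℝ} (hρ : |ρ| < r) (ϑ θ : ℝ) :
    ‖pairSumPath μ K ρ ϑ θ 0‖ ≤ 2 * T.umax := by
  have hρ' := abs_lt.1 hρ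
  rw [pairSumPath_apply_zero]
  refine (norm_add_le _ _).trans ?_
  have h₁ := norm_levelPoint_le_umax B hT hA (μ := μ) (ρ := 0) (by linarith) (by linarith) θ
  have h₂ := norm_levelPoint_le_umax B hT hA (μ := μ) (ρ := ρ) (by linarith) (by linarith) (ϑ + θ)
  linarith

/-- **The range of the pair-difference path**: `‖Φ(0,θ) − Φ(ρ,ϑ+θ)‖ ≤ 2·T.umax`. -/
theorem norm_pairDiffPath_zero_le_umax {μ r : ℝ} (hlo : a < μ - r - A) (hhi : μ + r + A < b) {ρ : ℝ} (hρ : |ρ| < r) (ϑ θ : ℝ) :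
    ‖pairDiffPath μ K ρ ϑ θ 0‖ ≤ 2 * T.umax := by
  have hρ' := abs_lt.1 hρ
  rw [pairDiffPath_apply_zero]
  refine (norm_sub_le _ _).trans ?_
  have h₁ := norm_levelPoint_le_umax B hT hA (μ := μ) (ρ := 0) (by linarith) (by linarith) θ
  have h₂ := norm_levelPoint_le_umax B hT hA (μ := μ) (ρ := ρ) (by linarith) (by linarith) (ϑ + θ)
  linarith

end Band

/-! ## The window of record `[-1.1, -0.1]`: `R₀ = 2·2.826 = 5.652` -/

section Window

variable {K : TrigPolyC4v} {A : ℝ} (hA : ∀ p : Momentum, ∀ j ≤ 2, ‖iteratedFDeriv ℝ j (frameShift K) p‖ ≤ A)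
  {μ r : ℝ} (hlo : (-1.1 : ℝ) < μ - r - A) (hhi : μ + r + A < -0.1) (hT : KlwjCertB)
include hA hlo hhi hT

/-- **On the window of record the pair-sum path stays in the ball of radius `5.652`** (`< 2π − 0.63`: away from the `2πℤ²`-images of the Cooper point),
given the certified polar-jet table `KlwjCertB`. -/
theorem norm_pairSumPath_zero_le_klwjB {ρ : ℝ} (hρ : |ρ| < r) (ϑ θ : ℝ) : ‖pairSumPath μ K ρ ϑ θ 0‖ ≤ 5.652 := by
  have h := norm_pairSumPath_zero_le_umax
    (bandBounds (show (-4 : ℝ) < -1.1 by norm_num) (show (-1.1 : ℝ) ≤ -0.1 by norm_num) (show (-0.1 : ℝ) < 0 by norm_num)) hT hA hlo hhi hρ ϑ θ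
  have hu : klwjTableB.umax = 2.826 := rfl
  rw [hu] at h
  linarith

/-- … and so does the pair-difference path (away from the images of the forward point). -/
theorem norm_pairDiffPath_zero_le_klwjB {ρ : ℝ} (hρ : |ρ| < r) (ϑ θ : ℝ) : ‖pairDiffPath μ K ρ ϑ θ 0‖ ≤ 5.652 := by
  have h := norm_pairDiffPath_zero_le_umax
    (bandBounds (show (-4 : ℝ) < -1.1 by norm_num) (show (-1.1 : ℝ) ≤ -0.1 by norm_num) (show (-0.1 : ℝ) < 0 by norm_num)) hT hA hlo hhi hρ ϑ θ
  have hu : klwjTableB.umax = 2.826 := rfl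
  rw [hu] at h
  linarith

end Window

end Summit.HubbardSuperconductivity.HubbardSuperconductivity.Theorems.C4a

end
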